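import Summits.ResolutionOfSingularities.ResolutionOfSingularities.Theses.HomologicalConductor

/-!
# Crux `NoZeno` (stmt-ResolutionOfSingularities-16483) — the valuative ORDER SKELETON of the crux:
# true along noetherian valuation rings, FALSE along every non-noetherian one

Route `ResolutionOfSingularities/HomologicalConductor`, crux
`Summit.ResolutionOfSingularities.ResolutionOfSingularities.Theses.HomologicalConductor.NoZeno`
(`Persistence → StrictDrop → valuative termination of the canonical normalised ca-tower`).
Negative lane (`--supports` the crux item); nothing here asserts a Theses decl.

What the two hypotheses of the crux hand to a termination proof, read as ORDER DATA along one
valuation ring `O` of `K`: a sequence of sets `c m ⊆ O` (the images of `ca(T_m)`), nested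
(`Persistence`: `c m ⊆ c (m+1)`), and the `StrictDrop` clause verbatim — while stage `m` is "bad",
some later `c m'` holds a nonzero `y` with `y * x⁻¹ ∉ O` for every nonzero `x ∈ c m` (the minimal
value drops strictly). "Good" in the crux is `IsRegularLocalRing (T_m)`, i.e. `1 ∈ ca(T_m)`
(`γ_m = 0`).

* `noZenoSkeleton_of_isNoetherianRing` — POSITIVE, for an ARBITRARY badness predicate and with NO
  monotonicity hypothesis: if `O` is noetherian (a field or a DVR) the drops alone force a good
  stage (strictly ascending chain of principal ideals `(y₁) < (y₂) < ⋯` of `O`). This is the entire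
  order-theoretic content of the birth line's `stub_noetherianCase` (what remains there is
  `T_m ⊆ O`); in particular `Persistence` is not needed along noetherian `O`.
* `not_noZenoSkeleton_rankOne` — NEGATIVE: along the natural (rank-one, value group `ℚ`,
  non-discrete) valuation ring of the Hahn-series field `ℚ⟦ℚ⟧` = `HahnSeries ℚ ℚ`, the principal
  ideals `c m = t^(1/2^m)·O` are nested, are `O`-ideals with an attained minimal value, drop
  strictly at EVERY step, and never contain `1`: a Zeno descent `γ_m = 2^{-m}`. So the named risk of
  the crux is real at the order level — `Persistence` and `StrictDrop` do NOT imply termination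
  along a non-discrete rank-one valuation by any argument that only uses the values of `ca(T_m)`;
  a proof of `stub_rankOneCase` must use arithmetic of the specific ideals `ca(T_m)` (e.g. bounded
  denominators of their values), not just the two sibling cruxes as order statements.
* `not_noZenoSkeleton_discreteRankTwo` — NEGATIVE: the same failure along the rank-two valuation
  ring of `HahnSeries (ℤ ×ₗ ℤ) ℚ`, whose value group `ℤ ×ₗ ℤ` is DISCRETE (finitely generated):
  `γ_m = (1, -m)`. "Discrete valuations are automatic" (crux docstring) is therefore true exactly
  for NOETHERIAN `O` (rank-one discrete), and the rank reduction `stub_rankReduction` has genuine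
  content already for discrete rank-two valuations.
* `noZeno_exists_hahnValuationSubring`, `noZeno_hahn_order_mul_inv`,
  `noZeno_hahnValuationSubring_not_isNoetherianRing` — the witnesses (existence form, to keep the
  file definition-free): the valuation ring `{f | 0 ≤ order f}` of `HahnSeries Γ R` for any
  linearly ordered abelian group `Γ` and field `R`, and its non-noetherianity for `Γ = ℚ`; reused by
  `NoZenoFalseWithoutFG.lean` (the hypothesis `A.FG` is load-bearing).

Kernel-only (axioms `propext`, `Classical.choice`, `Quot.sound`); no `def`, no named fact.
-/

set_option linter.dupNamespace false

noncomputable section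

namespace Summit.ResolutionOfSingularities.ResolutionOfSingularities.Theorems.NoZeno.Negative

open HahnSeries

/-! ## The witnesses: natural valuation rings of Hahn-series fields -/

/-- For every linearly ordered abelian group `Γ` and field `R`, the Hahn-series field
`HahnSeries Γ R` carries the valuation subring `{f | 0 ≤ order f}` (order of vanishing at the
origin; `order 0 = 0` by convention, so `0` is a member). Existence form — the file stays
definition-free. [folklore] -/
theorem noZeno_exists_hahnValuationSubring (Γ : Type) [AddCommGroup Γ] [LinearOrder Γ]
    [IsOrderedAddMonoid Γ] (R : Type) [Field R] :
    ∃ O : ValuationSubring (HahnSeries Γ R), ∀ f : HahnSeries Γ R, f ∈ O ↔ 0 ≤ f.order := by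
  refine ⟨{ carrier := {f | 0 ≤ f.order}
            mul_mem' := ?_, one_mem' := ?_, add_mem' := ?_, zero_mem' := ?_, neg_mem' := ?_,
            mem_or_inv_mem' := ?_ }, fun f => Iff.rfl⟩
  · intro a b ha hb
    simp only [Set.mem_setOf_eq] at ha hb ⊢
    by_cases ha0 : a = 0
    · simp [ha0]
    by_cases hb0 : b = 0
    · simp [hb0]
    rw [order_mul ha0 hb0]
    exact add_nonneg ha hb
  · simp
  · intro a b ha hb
    simp only [Set.mem_setOf_eq] at ha hb ⊢
    by_cases hab : a + b = 0
    · simp [hab]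
    exact (le_min ha hb).trans (min_order_le_order_add hab)
  · simp
  · intro a ha
    simp only [Set.mem_setOf_eq] at ha ⊢
    rwa [order_neg]
  · intro f
    simp only [Set.mem_setOf_eq]
    by_cases hf : f = 0
    · left; simp [hf]
    have hfi : f⁻¹ ≠ 0 := inv_ne_zero hf
    have h : f.order + f⁻¹.order = 0 := by
      rw [← order_mul hf hfi, mul_inv_cancel₀ hf, order_one]
    rcases le_total 0 f.order with h0 | h0
    · exact Or.inl h0
    · right
      rw [eq_neg_of_add_eq_zero_right h]
      exact neg_nonneg.mpr h0

/-- Order of a quotient of nonzero Hahn series: `order (y * x⁻¹) = order y - order x`.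
[folklore] -/
theorem noZeno_hahn_order_mul_inv {Γ : Type} [AddCommGroup Γ] [LinearOrder Γ]
    [IsOrderedAddMonoid Γ] {R : Type} [Field R] {x y : HahnSeries Γ R} (hx : x ≠ 0)
    (hy : y ≠ 0) : (y * x⁻¹).order = y.order - x.order := by
  have hxi : x⁻¹ ≠ 0 := inv_ne_zero hx
  have h : x.order + x⁻¹.order = 0 := by
    rw [← order_mul hx hxi, mul_inv_cancel₀ hx, order_one]
  rw [order_mul hy hxi, eq_neg_of_add_eq_zero_right h, sub_eq_add_neg]

/-- The natural valuation ring of `HahnSeries ℚ R` (value group `ℚ`: rank one, non-discrete) is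
NOT noetherian: the principal ideals `(t^(1/2^n))` ascend strictly forever. [folklore] -/
theorem noZeno_hahnValuationSubring_not_isNoetherianRing (R : Type) [Field R]
    (O : ValuationSubring (HahnSeries ℚ R)) (hO : ∀ f : HahnSeries ℚ R, f ∈ O ↔ 0 ≤ f.order) :
    ¬ IsNoetherianRing O := by
  intro hN
  have hmem : ∀ n : ℕ, (single (((2:ℚ) ^ n)⁻¹) (1 : R)) ∈ O := fun n => by
    rw [hO, order_single one_ne_zero]; positivity
  let g : ℕ → O := fun n => ⟨single (((2:ℚ) ^ n)⁻¹) (1 : R), hmem n⟩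
  let I : ℕ →o Ideal O :=
    { toFun := fun n => Ideal.span {g n}
      monotone' := by
        refine monotone_nat_of_le_succ fun n => ?_
        rw [Ideal.span_singleton_le_iff_mem, Ideal.mem_span_singleton]
        refine ⟨⟨single (((2:ℚ) ^ (n+1))⁻¹) (1 : R), hmem (n+1)⟩, ?_⟩
        apply Subtype.ext
        show single (((2:ℚ) ^ n)⁻¹) (1 : R) =
          single (((2:ℚ) ^ (n+1))⁻¹) 1 * single (((2:ℚ) ^ (n+1))⁻¹) 1
        rw [single_mul_single, mul_one]
        congr 1
        rw [pow_succ]; field_simp; ring }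
  obtain ⟨N, hN'⟩ := (monotone_stabilizes_iff_noetherian.mpr hN) I
  have hle : I (N+1) ≤ I N := (hN' (N+1) (Nat.le_succ N)).symm.le
  have hin : g (N+1) ∈ I N := hle (Ideal.mem_span_singleton_self _)
  rw [show I N = Ideal.span {g N} from rfl, Ideal.mem_span_singleton] at hin
  obtain ⟨q, hq⟩ := hin
  have hq' : (single (((2:ℚ) ^ (N+1))⁻¹) (1 : R)) =
      single (((2:ℚ) ^ N)⁻¹) (1 : R) * (q : HahnSeries ℚ R) :=
    congrArg Subtype.val hq
  have hq0 : (q : HahnSeries ℚ R) ≠ 0 := by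
    intro h0
    rw [h0, mul_zero] at hq'
    exact single_ne_zero one_ne_zero hq'
  have hord := congrArg HahnSeries.order hq'
  rw [order_single one_ne_zero, order_mul (single_ne_zero one_ne_zero) hq0,
    order_single one_ne_zero] at hord
  have hq1 : 0 ≤ (q : HahnSeries ℚ R).order := (hO q).mp q.2
  have : ((2:ℚ) ^ (N+1))⁻¹ < ((2:ℚ) ^ N)⁻¹ := by
    apply inv_strictAnti₀ (by positivity)
    exact pow_lt_pow_right₀ (by norm_num) (Nat.lt_succ_self N)
  linarith

/-! ## The order skeleton of `NoZeno`: positive along noetherian valuation rings -/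

/-- **The order skeleton holds along a noetherian valuation ring** — for ANY badness predicate
`Bad` on stages and WITHOUT monotonicity. Data: sets `c m ⊆ O` and the `StrictDrop` clause of the
crux verbatim (while stage `m` is bad, a later `c m'` contains a nonzero `y` with `y * x⁻¹ ∉ O`
for all nonzero `x ∈ c m`). Conclusion: some stage is good. Proof: otherwise the principal ideals
`(y)` of `O`, `y` ranging over the nonzero elements of the `c m`, have a maximal member
(noetherian), and one more drop produces a strictly larger one. This is the complete
order-theoretic content of the birth line's `stub_noetherianCase` (take `Bad m :=
¬ IsRegularLocalRing (T_m)`, `c m := ca(T_m)`; what remains is `T_m ⊆ O`), and it shows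
`Persistence` is unnecessary along noetherian `O`. [cite: ZariskiSamuel1960, Ch. VI §10] -/
theorem noZenoSkeleton_of_isNoetherianRing {K : Type} [Field K] (O : ValuationSubring K)
    (hO : IsNoetherianRing O) (Bad : ℕ → Prop) (c : ℕ → Set K) (hcO : ∀ m, c m ⊆ O)
    (hdrop : ∀ m, Bad m → ∃ m', m < m' ∧ ∃ y ∈ c m', y ≠ 0 ∧
      ∀ x ∈ c m, x ≠ 0 → y * x⁻¹ ∉ O) :
    ∃ m, ¬ Bad m := by
  by_contra hcon
  push Not at hcon
  let S : Set (Ideal O) :=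
    {I | ∃ m : ℕ, ∃ y : K, ∃ hy : y ∈ c m, y ≠ 0 ∧ I = Ideal.span {(⟨y, hcO m hy⟩ : O)}}
  have hS : S.Nonempty := by
    obtain ⟨m', -, y, hy, hy0, -⟩ := hdrop 0 (hcon 0)
    exact ⟨_, m', y, hy, hy0, rfl⟩
  obtain ⟨M, ⟨m, y, hy, hy0, rfl⟩, hmax⟩ := set_has_maximal_iff_noetherian.mpr hO S hS
  obtain ⟨m', -, y', hy', hy0', hlt⟩ := hdrop m (hcon m)
  have h1 : y' * y⁻¹ ∉ O := hlt y hy hy0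
  refine hmax (Ideal.span {(⟨y', hcO m' hy'⟩ : O)}) ⟨m', y', hy', hy0', rfl⟩
    (lt_of_le_of_ne ?_ ?_)
  · have hinv : y * y'⁻¹ ∈ O := by
      rcases O.mem_or_inv_mem (y' * y⁻¹) with h | h
      · exact absurd h h1
      · rwa [mul_inv_rev, inv_inv] at h
    rw [Ideal.span_singleton_le_iff_mem, Ideal.mem_span_singleton]
    refine ⟨⟨y * y'⁻¹, hinv⟩, Subtype.ext ?_⟩
    show y = y' * (y * y'⁻¹)
    field_simp
  · intro heq
    have hle : Ideal.span {(⟨y', hcO m' hy'⟩ : O)} ≤ Ideal.span {(⟨y, hcO m hy⟩ : O)} :=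
      heq.symm.le
    rw [Ideal.span_singleton_le_iff_mem, Ideal.mem_span_singleton] at hle
    obtain ⟨g, hg⟩ := hle
    have hg' : y' = y * g := congrArg Subtype.val hg
    apply h1
    have : y' * y⁻¹ = g := by rw [hg']; field_simp
    rw [this]; exact g.2

/-! ## The order skeleton of `NoZeno`: negative along non-noetherian valuation rings

The refuted statement is made as STRONG as the tower could ever supply: the `c m` contain `0`,
are `O`-ideals (more than ideals of `T_m`), are nested (`Persistence`), have an attained minimal
value (an admissible denominator `x` with `c m · x⁻¹ ⊆ O`, as for the finitely generated ideals
`ca(T_m)` of the noetherian `T_m`), and the drop happens at EVERY stage (more than `StrictDrop`);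
goodness is `1 ∈ c m` (`γ_m = 0`, i.e. `ca(T_m) = T_m`, i.e. `T_m` regular). -/

/-- **Zeno descent along a non-discrete rank-one valuation (the crux's named risk is real at the
order level).** Witness: `K = HahnSeries ℚ ℚ`, `O = {0 ≤ order}`, `c m = {0} ∪ {2^{-m} ≤ order}`
(the principal ideal `t^(1/2^m)·O`), `γ_m = 2^{-m} ↓ 0` never reaching `0`. Consequence for
provers: `Persistence ∧ StrictDrop ⇒ termination` cannot be proved along rank-one non-discrete
`O` from the VALUES of the `ca(T_m)` alone; `stub_rankOneCase` needs arithmetic input bounding the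
denominators of `γ_m` (compare: the same data DO suffice along noetherian `O`,
`noZenoSkeleton_of_isNoetherianRing`). [cite: CutkoskyMourtada2019, Introduction (defect and
rank-one non-discrete valuations as the obstruction to local uniformization)] -/
theorem not_noZenoSkeleton_rankOne : ¬ (∀ (K : Type) [Field K] (O : ValuationSubring K)
    (c : ℕ → Set K),
    (∀ m, c m ⊆ O) → (∀ m, (0 : K) ∈ c m) → (∀ m, ∀ x ∈ c m, ∀ o ∈ O, o * x ∈ c m) →
    (∀ m, c m ⊆ c (m + 1)) →
    (∀ m, ∃ x ∈ c m, x ≠ 0 ∧ ∀ x' ∈ c m, x' * x⁻¹ ∈ O) →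
    (∀ m, (1 : K) ∉ c m → ∃ m', m < m' ∧ ∃ y ∈ c m', y ≠ 0 ∧
      ∀ x ∈ c m, x ≠ 0 → y * x⁻¹ ∉ O) →
    ∃ m, (1 : K) ∈ c m) := by
  intro h
  obtain ⟨O, hO⟩ := noZeno_exists_hahnValuationSubring ℚ ℚ
  -- `c m` = the principal ideal `t^(1/2^m) · O` of the valuation ring
  set c : ℕ → Set (HahnSeries ℚ ℚ) := fun m => {f | f = 0 ∨ ((2:ℚ) ^ m)⁻¹ ≤ f.order} with hc
  have hq : ∀ m : ℕ, (0:ℚ) < ((2:ℚ) ^ m)⁻¹ := fun m => by positivity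
  have hanti : ∀ m : ℕ, ((2:ℚ) ^ (m+1))⁻¹ < ((2:ℚ) ^ m)⁻¹ := fun m => by
    apply inv_strictAnti₀ (by positivity)
    exact pow_lt_pow_right₀ (by norm_num) (Nat.lt_succ_self m)
  have h1 : ∀ m, c m ⊆ O := by
    intro m f hf
    rcases hf with rfl | hf
    · exact O.zero_mem
    · exact (hO f).mpr (by linarith [hq m])
  have h2 : ∀ m, (0 : HahnSeries ℚ ℚ) ∈ c m := fun m => Or.inl rfl
  have h3 : ∀ m, ∀ x ∈ c m, ∀ o ∈ O, o * x ∈ c m := by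
    intro m x hx o ho
    rcases hx with rfl | hx
    · simp [hc]
    · by_cases h0 : o * x = 0
      · exact Or.inl h0
      · right
        rw [order_mul (left_ne_zero_of_mul h0) (right_ne_zero_of_mul h0)]
        linarith [(hO o).mp ho]
  have h4 : ∀ m, c m ⊆ c (m + 1) := by
    intro m f hf
    rcases hf with rfl | hf
    · exact Or.inl rfl
    · exact Or.inr ((hanti m).le.trans hf)
  have h5 : ∀ m, ∃ x ∈ c m, x ≠ 0 ∧ ∀ x' ∈ c m, x' * x⁻¹ ∈ O := by
    intro m
    refine ⟨single (((2:ℚ) ^ m)⁻¹) 1, Or.inr (by rw [order_single one_ne_zero]),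
      single_ne_zero one_ne_zero, ?_⟩
    intro x' hx'
    rcases hx' with rfl | hx'
    · simp
    · by_cases hx0 : x' = 0
      · simp [hx0]
      rw [hO, noZeno_hahn_order_mul_inv (single_ne_zero one_ne_zero) hx0,
        order_single one_ne_zero]
      linarith
  have h6 : ∀ m, (1 : HahnSeries ℚ ℚ) ∉ c m → ∃ m', m < m' ∧ ∃ y ∈ c m', y ≠ 0 ∧
      ∀ x ∈ c m, x ≠ 0 → y * x⁻¹ ∉ O := by
    intro m _
    refine ⟨m + 1, Nat.lt_succ_self m, single (((2:ℚ) ^ (m+1))⁻¹) 1,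
      Or.inr (by rw [order_single one_ne_zero]), single_ne_zero one_ne_zero, ?_⟩
    intro x hx hx0
    rcases hx with rfl | hx
    · exact absurd rfl hx0
    · rw [hO, noZeno_hahn_order_mul_inv hx0 (single_ne_zero one_ne_zero),
        order_single one_ne_zero]
      linarith [hanti m]
  obtain ⟨m, hm⟩ := h (HahnSeries ℚ ℚ) O c h1 h2 h3 h4 h5 h6
  rcases hm with hm | hm
  · exact one_ne_zero hm
  · rw [order_one] at hm
    linarith [hq m]

/-- **The skeleton also fails along a DISCRETE valuation of rank two** (value group `ℤ ×ₗ ℤ`,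
finitely generated). Witness: `K = HahnSeries (ℤ ×ₗ ℤ) ℚ`, `O = {0 ≤ order}`,
`c m = {0} ∪ {(1, -m) ≤ order}`, `γ_m = (1, -m)` strictly decreasing, positive forever. So
"discrete valuations are automatic" holds exactly for NOETHERIAN `O` (rank-one discrete), and the
rank reduction (`stub_rankReduction`, print analogue Novacoski–Spivakovsky) has order-theoretic
content already in discrete rank two; likewise a finitely generated value group (Abhyankar
valuations) does not by itself exclude Zeno behaviour of the tower.
[cite: NovacoskiSpivakovsky2014, Thm 1.1 (reduction of local uniformization to rank one)] -/
theorem not_noZenoSkeleton_discreteRankTwo : ¬ (∀ (K : Type) [Field K] (O : ValuationSubring K)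
    (c : ℕ → Set K),
    (∀ m, c m ⊆ O) → (∀ m, (0 : K) ∈ c m) → (∀ m, ∀ x ∈ c m, ∀ o ∈ O, o * x ∈ c m) →
    (∀ m, c m ⊆ c (m + 1)) →
    (∀ m, ∃ x ∈ c m, x ≠ 0 ∧ ∀ x' ∈ c m, x' * x⁻¹ ∈ O) →
    (∀ m, (1 : K) ∉ c m → ∃ m', m < m' ∧ ∃ y ∈ c m', y ≠ 0 ∧
      ∀ x ∈ c m, x ≠ 0 → y * x⁻¹ ∉ O) →
    ∃ m, (1 : K) ∈ c m) := by
  intro h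
  obtain ⟨O, hO⟩ := noZeno_exists_hahnValuationSubring (ℤ ×ₗ ℤ) ℚ
  -- γ m = (1, -m): strictly decreasing, positive, never ≤ 0
  set γ : ℕ → ℤ ×ₗ ℤ := fun m => toLex ((1 : ℤ), -(m : ℤ)) with hγ
  have hγpos : ∀ m, (0 : ℤ ×ₗ ℤ) < γ m := fun m =>
    (Prod.Lex.toLex_lt_toLex (x := ((0:ℤ), (0:ℤ)))).mpr (Or.inl (show (0:ℤ) < 1 by norm_num))
  have hγanti : ∀ m, γ (m + 1) < γ m := fun m =>
    Prod.Lex.toLex_lt_toLex.mpr (Or.inr ⟨rfl, by push_cast; omega⟩)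
  have hγsub : ∀ m, γ (m + 1) - γ m < 0 := fun m => sub_neg.mpr (hγanti m)
  set c : ℕ → Set (HahnSeries (ℤ ×ₗ ℤ) ℚ) := fun m => {f | f = 0 ∨ γ m ≤ f.order} with hc
  have h1 : ∀ m, c m ⊆ O := by
    intro m f hf
    rcases hf with rfl | hf
    · exact O.zero_mem
    · exact (hO f).mpr ((hγpos m).le.trans hf)
  have h2 : ∀ m, (0 : HahnSeries (ℤ ×ₗ ℤ) ℚ) ∈ c m := fun m => Or.inl rfl
  have h3 : ∀ m, ∀ x ∈ c m, ∀ o ∈ O, o * x ∈ c m := by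
    intro m x hx o ho
    rcases hx with rfl | hx
    · simp [hc]
    · by_cases h0 : o * x = 0
      · exact Or.inl h0
      · right
        rw [order_mul (left_ne_zero_of_mul h0) (right_ne_zero_of_mul h0)]
        exact hx.trans (le_add_of_nonneg_left ((hO o).mp ho))
  have h4 : ∀ m, c m ⊆ c (m + 1) := by
    intro m f hf
    rcases hf with rfl | hf
    · exact Or.inl rfl
    · exact Or.inr ((hγanti m).le.trans hf)
  have h5 : ∀ m, ∃ x ∈ c m, x ≠ 0 ∧ ∀ x' ∈ c m, x' * x⁻¹ ∈ O := by
    intro m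
    refine ⟨single (γ m) 1, Or.inr (by rw [order_single one_ne_zero]),
      single_ne_zero one_ne_zero, ?_⟩
    intro x' hx'
    rcases hx' with rfl | hx'
    · simp
    · by_cases hx0 : x' = 0
      · simp [hx0]
      rw [hO, noZeno_hahn_order_mul_inv (single_ne_zero one_ne_zero) hx0,
        order_single one_ne_zero]
      exact sub_nonneg.mpr hx'
  have h6 : ∀ m, (1 : HahnSeries (ℤ ×ₗ ℤ) ℚ) ∉ c m → ∃ m', m < m' ∧ ∃ y ∈ c m', y ≠ 0 ∧
      ∀ x ∈ c m, x ≠ 0 → y * x⁻¹ ∉ O := by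
    intro m _
    refine ⟨m + 1, Nat.lt_succ_self m, single (γ (m + 1)) 1,
      Or.inr (by rw [order_single one_ne_zero]), single_ne_zero one_ne_zero, ?_⟩
    intro x hx hx0
    rcases hx with rfl | hx
    · exact absurd rfl hx0
    · rw [hO, noZeno_hahn_order_mul_inv hx0 (single_ne_zero one_ne_zero),
        order_single one_ne_zero, not_le]
      exact (sub_le_sub_left hx _).trans_lt (hγsub m)
  obtain ⟨m, hm⟩ := h (HahnSeries (ℤ ×ₗ ℤ) ℚ) O c h1 h2 h3 h4 h5 h6
  rcases hm with hm | hm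
  · exact one_ne_zero hm
  · rw [order_one] at hm
    exact absurd hm (not_le.mpr (hγpos m))

end Summit.ResolutionOfSingularities.ResolutionOfSingularities.Theorems.NoZeno.Negative

end
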